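import Literature.MathematicalPhysics.QuantumLattice.TwistedBoundaryConditions
import HarnessLib

/-!
# Uniqueness of irreducible twist eaters — proof of `TwistEaterUniqueness`

Discharge of the named fact `Literature.MathematicalPhysics.QuantumLattice.TwistEaterUniqueness`
(García Pérez–González-Arroyo–Okawa 2014, §2: for irreducible twists "the solutions to
`Γ_μ Γ_ν = Z_{μν} Γ_ν Γ_μ` are unique modulo similarity transformations (global gauge
transformations) and multiplication by an element of `Z_N`"), stated in
`TwistedBoundaryConditions.lean`; this file only adds theorems (`TwistEaterUniqueness_holds` and
its matrix-algebra helpers in `namespace TwistEaterUniqueness`).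

## References

* M. García Pérez, A. González-Arroyo, M. Okawa, *Volume independence for Yang–Mills fields on the
  twisted torus*, Int. J. Mod. Phys. A 29 (2014) 1445001, arXiv:1406.5655, §2.
  [GarciaperezGonzalezarroyoOkawa2014]
* A. González-Arroyo, *Yang–Mills fields on the four-dimensional torus. Part I: Classical theory*,
  hep-th/9807108, §4.2. [Gonzalezarroyo1998]
-/

noncomputable section

namespace Literature.MathematicalPhysics.QuantumLattice

variable {d N : ℕ}

/-! ## Proof of `TwistEaterUniqueness`

The source states the uniqueness and refers to González-Arroyo's review and to van Baal–van Geemen and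
Lebedev–Polikarpov for the representation theory of the twist ("Weyl–'t Hooft") relations. We
formalize the standard finite-Heisenberg-group argument directly in matrix language:

1. *Scalars.* By irreducibility of the family `Γ`, every twist `z_{μν}` (central in `SU(N)`, hence
   commuting with all `Γ_ρ`) is a scalar `ζ_{μν} · 1` with `ζ_{μν}^N = 1`; and `Γ_μ^N` commutes with
   every `Γ_ν` (the phases `ζ^{±N} = 1` drop out), so `Γ_μ^N = c_μ · 1` with `c_μ^N = det Γ_μ^N = 1`,
   whence `Γ_μ^{N²} = 1` (same for `Γ'`).
2. *Averaging.* For `M = N²`, `ξ = e^{2πi/M}` and a direction `μ`, the phase-twisted average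
   `P_κ(Y) = ∑_{j<M} ξ^{κj} Γ'_μ{}^j Y (Γ_μ^†)^j` satisfies `Γ'_μ P_κ(Y) Γ_μ^† = ξ^{-κ} P_κ(Y)`
   (cyclic reindexing, `TwistEaterUniqueness.mul_avg_mul`), preserves any relation
   `Γ'_ν Y Γ_ν^† = c Y` already obtained (the commutation phases of `Γ` and `Γ'` are the same and
   cancel, `TwistEaterUniqueness.avg_preserves`), and `∑_κ P_κ(Y) = M · Y`
   (`TwistEaterUniqueness.sum_avg`), so some `P_κ(Y) ≠ 0` when `Y ≠ 0`. Iterating over the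
   directions starting from `Y = 1` gives `Ω ≠ 0` with `Γ'_ν Ω Γ_ν^† = c_ν Ω`, `|c_ν| = 1`, for
   all `ν` (`TwistEaterUniqueness.exists_twisted_invariant`).
3. *Schur.* `Ω^† Ω` commutes with every `Γ_ν`, so `Ω^† Ω = r · 1` with `r > 0`; `U = Ω/√r` is
   unitary and `Γ'_ν U = c_ν U Γ_ν` (`TwistEaterUniqueness.exists_unitary_intertwiner`).
4. *Normalisation.* Rescaling `U` by an `N`-th root of `det U⁻¹` gives `V ∈ SU(N)` with
   `Γ'_ν = c_ν V Γ_ν V^†`; taking determinants, `c_ν^N = 1`, so `c_ν = ω^{k_ν}` is a centre phase.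
-/

open scoped ComplexOrder Matrix

namespace TwistEaterUniqueness

/-- `A B = φ • B A` implies `Aʲ B = φʲ • B Aʲ`. [folklore] -/
theorem pow_mul_eq_smul {A B : Matrix (Fin N) (Fin N) ℂ} {φ : ℂ}
    (h : A * B = φ • (B * A)) (j : ℕ) : A ^ j * B = φ ^ j • (B * A ^ j) := by
  induction j with
  | zero => simp
  | succ j ih =>
    rw [pow_succ, mul_assoc, h, mul_smul_comm, ← mul_assoc, ih, smul_mul_assoc, smul_smul,
      pow_succ, mul_comm (φ ^ j) φ, mul_assoc]

/-- `A B = φ • B A` implies `A Bʲ = φʲ • Bʲ A`. [folklore] -/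
theorem mul_pow_eq_smul {A B : Matrix (Fin N) (Fin N) ℂ} {φ : ℂ}
    (h : A * B = φ • (B * A)) (j : ℕ) : A * B ^ j = φ ^ j • (B ^ j * A) := by
  induction j with
  | zero => simp
  | succ j ih =>
    rw [pow_succ, ← mul_assoc, ih, smul_mul_assoc, mul_assoc, h, mul_smul_comm, smul_smul,
      ← mul_assoc, pow_succ]

/-- A complex number with `x ^ n = 1`, `n ≠ 0`, has norm one. [folklore] -/
theorem norm_eq_one_of_pow_eq_one {x : ℂ} {n : ℕ} (hn : n ≠ 0) (h : x ^ n = 1) : ‖x‖ = 1 := by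
  have : ‖x‖ ^ n = 1 := by rw [← norm_pow, h, norm_one]
  exact (pow_eq_one_iff_of_nonneg (norm_nonneg x) hn).1 this

/-- For a unit complex number `c`, `c̄ c = 1`. [folklore] -/
theorem star_mul_self_of_norm_eq_one {c : ℂ} (hc : ‖c‖ = 1) : star c * c = 1 := by
  have : (starRingEnd ℂ) c * c = ((‖c‖ ^ 2 : ℝ) : ℂ) := by exact_mod_cast Complex.conj_mul' c
  rw [hc] at this
  simpa using this

/-- **Cyclic reindexing of the phase-twisted average.** For `P(Y) = ∑_{j<M} wʲ A'ʲ Y Bʲ` with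
`A'^M = B^M = 1` and `w^M = 1`: `A' P(Y) B = w⁻¹ P(Y)`. [folklore] -/
theorem mul_avg_mul {M : ℕ} {w : ℂ} {A' B : Matrix (Fin N) (Fin N) ℂ} (hw : w ^ M = 1)
    (hw0 : w ≠ 0) (hA' : A' ^ M = 1) (hB : B ^ M = 1) (Y : Matrix (Fin N) (Fin N) ℂ) :
    A' * (∑ j ∈ Finset.range M, w ^ j • (A' ^ j * Y * B ^ j)) * B =
      w⁻¹ • ∑ j ∈ Finset.range M, w ^ j • (A' ^ j * Y * B ^ j) := by
  obtain ⟨f, hf⟩ : ∃ f : ℕ → Matrix (Fin N) (Fin N) ℂ,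
      f = fun j => w ^ j • (A' ^ j * Y * B ^ j) := ⟨_, rfl⟩
  have havg : (∑ j ∈ Finset.range M, w ^ j • (A' ^ j * Y * B ^ j)) =
      ∑ j ∈ Finset.range M, f j := by rw [hf]
  have hfM : f M = f 0 := by simp [hf, hw, hA', hB]
  have hshift : ∑ j ∈ Finset.range M, f (j + 1) = ∑ j ∈ Finset.range M, f j := by
    have h1 := Finset.sum_range_succ' f M
    have h2 := Finset.sum_range_succ f M
    rw [hfM] at h2
    exact add_right_cancel (h1.symm.trans h2)
  have hterm : ∀ j, A' * f j * B = w⁻¹ • f (j + 1) := by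
    intro j
    rw [hf]
    dsimp only
    rw [Matrix.mul_smul, Matrix.smul_mul, smul_smul, pow_succ' w, inv_mul_cancel_left₀ hw0,
      pow_succ' A', pow_succ B]
    congr 1
    simp only [mul_assoc]
  rw [havg, Finset.mul_sum, Finset.sum_mul]
  simp_rw [hterm]
  rw [← Finset.smul_sum, hshift]

/-- **The average in direction `μ` preserves a twisted invariance in direction `ν`**: if
`A'_ν A' = φ A' A'_ν`, `B B_ν = φ̄ B_ν B` (`|φ| = 1`) and `A'_ν Y B_ν = c Y`, then
`A'_ν P(Y) B_ν = c P(Y)` for `P(Y) = ∑_{j<M} wʲ A'ʲ Y Bʲ`. [folklore] -/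
theorem avg_preserves {M : ℕ} {w : ℂ} {A' B Aν' Bν : Matrix (Fin N) (Fin N) ℂ} {φ : ℂ}
    (hφ : ‖φ‖ = 1) (hA : Aν' * A' = φ • (A' * Aν')) (hB : B * Bν = (star φ) • (Bν * B))
    {Y : Matrix (Fin N) (Fin N) ℂ} {c : ℂ} (hY : Aν' * Y * Bν = c • Y) :
    Aν' * (∑ j ∈ Finset.range M, w ^ j • (A' ^ j * Y * B ^ j)) * Bν =
      c • ∑ j ∈ Finset.range M, w ^ j • (A' ^ j * Y * B ^ j) := by
  rw [Finset.mul_sum, Finset.sum_mul, Finset.smul_sum]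
  refine Finset.sum_congr rfl fun j _ => ?_
  have h1 : Aν' * A' ^ j = φ ^ j • (A' ^ j * Aν') := mul_pow_eq_smul hA j
  have h2 : B ^ j * Bν = (star φ) ^ j • (Bν * B ^ j) := pow_mul_eq_smul hB j
  have hφφ : φ * star φ = 1 := by rw [mul_comm]; exact star_mul_self_of_norm_eq_one hφ
  calc Aν' * (w ^ j • (A' ^ j * Y * B ^ j)) * Bν
      = w ^ j • ((Aν' * A' ^ j) * Y * (B ^ j * Bν)) := by
        rw [Matrix.mul_smul, Matrix.smul_mul]; congr 1; simp only [mul_assoc]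
    _ = w ^ j • ((φ * star φ) ^ j • (A' ^ j * (Aν' * Y * Bν) * B ^ j)) := by
        rw [h1, h2, mul_pow, ← smul_smul, Matrix.smul_mul, Matrix.smul_mul, Matrix.mul_smul]
        congr 3
        simp only [mul_assoc]
    _ = c • (w ^ j • (A' ^ j * Y * B ^ j)) := by
        rw [hφφ, one_pow, one_smul, hY, Matrix.mul_smul, Matrix.smul_mul, smul_comm]

/-- **Fourier inversion at `j = 0`**: summing the averages `P_κ(Y) = ∑_{j<M} ξ^{κj} A'ʲ Y Bʲ` over
`κ < M`, `ξ` a primitive `M`-th root of unity, gives `M · Y` (only `j = 0` survives). [folklore] -/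
theorem sum_avg {M : ℕ} (hM : 0 < M) {ξ : ℂ} (hξ : IsPrimitiveRoot ξ M)
    (A' B Y : Matrix (Fin N) (Fin N) ℂ) :
    ∑ κ ∈ Finset.range M, ∑ j ∈ Finset.range M, (ξ ^ κ) ^ j • (A' ^ j * Y * B ^ j) =
      (M : ℂ) • Y := by
  rw [Finset.sum_comm]
  have hgeom : ∀ j ∈ Finset.range M, ∑ κ ∈ Finset.range M, (ξ ^ κ) ^ j =
      if j = 0 then (M : ℂ) else 0 := by
    intro j hj
    split_ifs with hj0
    · simp [hj0]
    · have hne : ξ ^ j ≠ 1 := by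
        rw [Ne, hξ.pow_eq_one_iff_dvd]
        exact fun hdvd => hj0 (Nat.eq_zero_of_dvd_of_lt hdvd (Finset.mem_range.1 hj))
      simp_rw [← pow_mul, mul_comm _ j, pow_mul]
      rw [geom_sum_eq hne, ← pow_mul, mul_comm j M, pow_mul, hξ.pow_eq_one, one_pow, sub_self,
        zero_div]
  have : ∀ j ∈ Finset.range M, ∑ κ ∈ Finset.range M, (ξ ^ κ) ^ j • (A' ^ j * Y * B ^ j) =
      (if j = 0 then (M : ℂ) else 0) • (A' ^ j * Y * B ^ j) := by
    intro j hj
    rw [← Finset.sum_smul, hgeom j hj]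
  rw [Finset.sum_congr rfl this, Finset.sum_eq_single_of_mem 0 (Finset.mem_range.2 hM)]
  · simp
  · intro j _ hj0
    simp [hj0]

/-- **Iterated averaging.** For two `d`-tuples of matrices with `G_μ^M = G'_μ{}^M = 1` and the SAME
unit commutation phases (`G_μ G_ν = φ G_ν G_μ`, `G'_μ G'_ν = φ G'_ν G'_μ`), there is a non-zero `Ω`
with `G'_ν Ω G_ν^† = c_ν Ω`, `|c_ν| = 1`, for every direction `ν` (average direction by direction,
choosing each time a phase `κ` for which the average stays non-zero). [folklore] -/
theorem exists_twisted_invariant [NeZero N] (G G' : Fin d → Matrix (Fin N) (Fin N) ℂ)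
    {M : ℕ} (hM : 0 < M) (hpow : ∀ μ, G μ ^ M = 1) (hpow' : ∀ μ, G' μ ^ M = 1)
    (hcomm : ∀ μ ν, ∃ φ : ℂ, ‖φ‖ = 1 ∧ G μ * G ν = φ • (G ν * G μ) ∧
      G' μ * G' ν = φ • (G' ν * G' μ)) :
    ∃ Ω : Matrix (Fin N) (Fin N) ℂ, Ω ≠ 0 ∧
      ∀ ν, ∃ c : ℂ, ‖c‖ = 1 ∧ G' ν * Ω * (G ν)ᴴ = c • Ω := by
  classical
  have hM0 : M ≠ 0 := hM.ne'
  set ξ : ℂ := Complex.exp (2 * Real.pi * Complex.I / M) with hξ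
  have hprim : IsPrimitiveRoot ξ M := Complex.isPrimitiveRoot_exp M hM0
  have hpowH : ∀ μ, (G μ)ᴴ ^ M = 1 := fun μ => by
    rw [← Matrix.conjTranspose_pow, hpow μ, Matrix.conjTranspose_one]
  have key : ∀ S : Finset (Fin d), ∃ Ω : Matrix (Fin N) (Fin N) ℂ, Ω ≠ 0 ∧
      ∀ ν ∈ S, ∃ c : ℂ, ‖c‖ = 1 ∧ G' ν * Ω * (G ν)ᴴ = c • Ω := by
    intro S
    induction S using Finset.induction_on with
    | empty => exact ⟨1, one_ne_zero, fun ν hν => absurd hν (Finset.notMem_empty ν)⟩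
    | insert μ S _ ih =>
      obtain ⟨Ω, hΩ0, hΩ⟩ := ih
      obtain ⟨P, hP⟩ : ∃ P : ℕ → Matrix (Fin N) (Fin N) ℂ,
          ∀ κ, P κ = ∑ j ∈ Finset.range M, (ξ ^ κ) ^ j • (G' μ ^ j * Ω * (G μ)ᴴ ^ j) :=
        ⟨_, fun _ => rfl⟩
      have hex : ∃ κ ∈ Finset.range M, P κ ≠ 0 := by
        by_contra hall
        push Not at hall
        have hsum := sum_avg hM hprim (G' μ) (G μ)ᴴ Ω
        simp_rw [← hP] at hsum
        rw [Finset.sum_eq_zero hall] at hsum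
        exact hΩ0 ((smul_eq_zero.1 hsum.symm).resolve_left (Nat.cast_ne_zero.2 hM0))
      obtain ⟨κ, -, hne⟩ := hex
      refine ⟨P κ, hne, fun ν hν => ?_⟩
      rcases Finset.mem_insert.1 hν with rfl | hν
      · have hw : (ξ ^ κ) ^ M = 1 := by
          rw [← pow_mul, mul_comm, pow_mul, hprim.pow_eq_one, one_pow]
        have hw1 : ‖ξ ^ κ‖ = 1 := norm_eq_one_of_pow_eq_one hM0 hw
        have hw0 : ξ ^ κ ≠ 0 := fun h => by simp [h] at hw1
        refine ⟨(ξ ^ κ)⁻¹, by rw [norm_inv, hw1, inv_one], ?_⟩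
        rw [hP]
        exact mul_avg_mul hw hw0 (hpow' ν) (hpowH ν) Ω
      · obtain ⟨c, hc, hcΩ⟩ := hΩ ν hν
        obtain ⟨φ, hφ, hG, hG'⟩ := hcomm ν μ
        refine ⟨c, hc, ?_⟩
        rw [hP]
        refine avg_preserves hφ hG' ?_ hcΩ
        rw [← Matrix.conjTranspose_mul, hG, Matrix.conjTranspose_smul, Matrix.conjTranspose_mul]
  obtain ⟨Ω, hΩ0, hΩ⟩ := key Finset.univ
  exact ⟨Ω, hΩ0, fun ν => hΩ ν (Finset.mem_univ ν)⟩

/-- **Schur step.** A non-zero twisted intertwiner `Ω` (`G'_ν Ω G_ν^† = c_ν Ω`, `|c_ν| = 1`) between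
a unitary family `G'` and an IRREDUCIBLE unitary family `G` is a positive multiple of a unitary
`U` with `G'_ν U = c_ν U G_ν`: `Ω^†Ω` lies in the commutant of `G`, hence is a scalar `r > 0`.
[folklore] -/
theorem exists_unitary_intertwiner [NeZero N] (G G' : Fin d → Matrix (Fin N) (Fin N) ℂ)
    (hU : ∀ μ, (G μ)ᴴ * G μ = 1) (hU' : ∀ μ, (G' μ)ᴴ * G' μ = 1)
    (hirr : IsIrreducibleFamily G) {Ω : Matrix (Fin N) (Fin N) ℂ} (hΩ0 : Ω ≠ 0) {c : Fin d → ℂ}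
    (hc : ∀ ν, ‖c ν‖ = 1) (hΩ : ∀ ν, G' ν * Ω * (G ν)ᴴ = c ν • Ω) :
    ∃ U : Matrix (Fin N) (Fin N) ℂ, Uᴴ * U = 1 ∧ ∀ ν, G' ν * U = c ν • (U * G ν) := by
  have hrel : ∀ ν, G' ν * Ω = c ν • (Ω * G ν) := fun ν => by
    have h := congrArg (· * G ν) (hΩ ν)
    simp only [mul_assoc, hU ν, mul_one, Matrix.smul_mul] at h
    simpa [mul_assoc] using h
  set X := Ωᴴ * Ω with hX
  have hXcomm : ∀ ν, X * G ν = G ν * X := by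
    intro ν
    have h1 : (G' ν * Ω)ᴴ * (G' ν * Ω) = X := by
      rw [Matrix.conjTranspose_mul, mul_assoc, ← mul_assoc (G' ν)ᴴ, hU' ν, one_mul]
    have h2 : (G' ν * Ω)ᴴ * (G' ν * Ω) = (G ν)ᴴ * X * G ν := by
      rw [hrel ν, Matrix.conjTranspose_smul, Matrix.smul_mul, Matrix.mul_smul, smul_smul,
        star_mul_self_of_norm_eq_one (hc ν), one_smul, Matrix.conjTranspose_mul, hX]
      simp only [mul_assoc]
    have h3 : (G ν)ᴴ * X * G ν = X := h2.symm.trans h1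
    have hGG : G ν * (G ν)ᴴ = 1 := mul_eq_one_comm.1 (hU ν)
    calc X * G ν = G ν * (G ν)ᴴ * X * G ν := by rw [hGG, one_mul]
      _ = G ν * ((G ν)ᴴ * X * G ν) := by simp only [mul_assoc]
      _ = G ν * X := by rw [h3]
  obtain ⟨r, hr⟩ := hirr X hXcomm
  have hr0 : r ≠ 0 := by
    rintro rfl
    rw [zero_smul] at hr
    exact hΩ0 (Matrix.conjTranspose_mul_self_eq_zero.1 hr)
  set t : ℝ := ∑ i, Complex.normSq (Ω i 0) with ht
  have hrt : r = (t : ℂ) := by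
    have h := congrFun (congrFun hr 0) 0
    simp only [hX, Matrix.mul_apply, Matrix.conjTranspose_apply, Matrix.smul_apply,
      Matrix.one_apply_eq, smul_eq_mul, mul_one] at h
    rw [← h, ht, Complex.ofReal_sum]
    refine Finset.sum_congr rfl fun i _ => ?_
    rw [Complex.star_def, ← Complex.normSq_eq_conj_mul_self]
  have ht0 : 0 ≤ t := Finset.sum_nonneg fun i _ => Complex.normSq_nonneg _
  have htpos : 0 < t :=
    lt_of_le_of_ne ht0 (fun h => hr0 (by rw [hrt, ← h, Complex.ofReal_zero]))
  set s : ℝ := (Real.sqrt t)⁻¹ with hs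
  have hss : (s : ℂ) * s * r = 1 := by
    rw [hrt, ← Complex.ofReal_mul, ← Complex.ofReal_mul, hs, ← mul_inv, Real.mul_self_sqrt ht0,
      inv_mul_cancel₀ htpos.ne', Complex.ofReal_one]
  refine ⟨(s : ℂ) • Ω, ?_, fun ν => ?_⟩
  · rw [Matrix.conjTranspose_smul, Matrix.smul_mul, Matrix.mul_smul, smul_smul, ← hX, hr,
      smul_smul, Complex.star_def, Complex.conj_ofReal, hss, one_smul]
  · rw [Matrix.mul_smul, Matrix.smul_mul, hrel ν, smul_comm]

/-- **`N`-th powers of an irreducible solution are trivial up to `N²`.** If `F` is an irreducible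
family of determinant-one matrices whose members commute up to phases `φ` with `φ^N = 1`, then
`F_μ^N` is in the commutant, hence a scalar `c_μ` with `c_μ^N = det F_μ^N = 1`, so `F_μ^{N·N} = 1`.
[folklore] -/
theorem pow_mul_self_eq_one (F : Fin d → Matrix (Fin N) (Fin N) ℂ) (hF : IsIrreducibleFamily F)
    (hdetF : ∀ μ, (F μ).det = 1)
    (hcF : ∀ μ ν, ∃ φ : ℂ, φ ^ N = 1 ∧ F μ * F ν = φ • (F ν * F μ)) (μ : Fin d) :
    F μ ^ (N * N) = 1 := by
  have hc : ∀ ν, F μ ^ N * F ν = F ν * F μ ^ N := by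
    intro ν
    obtain ⟨φ, hφN, hφ⟩ := hcF μ ν
    rw [pow_mul_eq_smul hφ N, hφN, one_smul]
  obtain ⟨c, hc'⟩ := hF _ hc
  have hcN : c ^ N = 1 := by
    have h := congrArg Matrix.det hc'
    rw [Matrix.det_pow, hdetF, one_pow, Matrix.det_smul, Matrix.det_one, mul_one,
      Fintype.card_fin] at h
    exact h.symm
  rw [pow_mul, hc', smul_pow, one_pow, hcN, one_smul]

end TwistEaterUniqueness

/-- **Uniqueness of irreducible twist eaters** — discharge of the named fact
`TwistEaterUniqueness`: two `d`-tuples `Γ, Γ'` in `SU(N)` solving `Γ_μ Γ_ν = z_{μν} Γ_ν Γ_μ` for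
the same centre-valued twist `z`, each with trivial commutant, are related by
`Γ'_μ = ω^{k_μ} Ω Γ_μ Ω⁻¹` for one `Ω ∈ SU(N)` and centre phases `ω^{k_μ}` ("the solutions … are
unique modulo similarity transformations (global gauge transformations) and multiplication by an
element of `Z_N`"). Proof: scalars / phase-twisted averaging / Schur / determinant normalisation,
see the section docstring above (the standard argument for the finite Heisenberg group of the
twist, for which the source refers to González-Arroyo 1998 §4.2, van Baal–van Geemen and
Lebedev–Polikarpov). [cite: GarciaperezGonzalezarroyoOkawa2014, §2] -/
theorem TwistEaterUniqueness_holds : TwistEaterUniqueness := by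
  intro N d _ z Γ Γ' hΓ hΓ' hirr hirr'
  classical
  have hN0 : N ≠ 0 := NeZero.ne N
  have hNpos : 0 < N := Nat.pos_of_ne_zero hN0
  -- the two families as complex matrices
  set G : Fin d → Matrix (Fin N) (Fin N) ℂ := fun μ => (Γ μ : Matrix (Fin N) (Fin N) ℂ) with hG
  set G' : Fin d → Matrix (Fin N) (Fin N) ℂ := fun μ => (Γ' μ : Matrix (Fin N) (Fin N) ℂ) with hG'
  have hirrG : IsIrreducibleFamily G := hirr
  have hirrG' : IsIrreducibleFamily G' := hirr'
  have hU : ∀ μ, (G μ)ᴴ * G μ = 1 := fun μ => (Γ μ).prop.1.1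
  have hU' : ∀ μ, (G' μ)ᴴ * G' μ = 1 := fun μ => (Γ' μ).prop.1.1
  have hdet : ∀ μ, (G μ).det = 1 := fun μ => (Matrix.mem_specialUnitaryGroup_iff.1 (Γ μ).prop).2
  have hdet' : ∀ μ, (G' μ).det = 1 := fun μ => (Matrix.mem_specialUnitaryGroup_iff.1 (Γ' μ).prop).2
  -- Step 1a: the twists are scalar `N`-th roots of unity (irreducibility of `Γ`)
  have hz : ∀ p : Plane d, ∃ ζ : ℂ, ‖ζ‖ = 1 ∧ ζ ^ N = 1 ∧
      ((z p : Matrix.specialUnitaryGroup (Fin N) ℂ) : Matrix (Fin N) (Fin N) ℂ) = ζ • 1 := by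
    intro p
    have hcommz : ∀ τ, ((z p : Matrix.specialUnitaryGroup (Fin N) ℂ) : Matrix (Fin N) (Fin N) ℂ)
        * G τ = G τ * ((z p : Matrix.specialUnitaryGroup (Fin N) ℂ) : Matrix (Fin N) (Fin N) ℂ) := by
      intro τ
      have h := congrArg Subtype.val (Subgroup.mem_center_iff.1 (z p).2 (Γ τ))
      exact h.symm
    obtain ⟨ζ, hζ⟩ := hirrG _ hcommz
    have hζN : ζ ^ N = 1 := by
      have hd := (Matrix.mem_specialUnitaryGroup_iff.1
        (z p : Matrix.specialUnitaryGroup (Fin N) ℂ).prop).2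
      rw [hζ, Matrix.det_smul, Matrix.det_one, mul_one, Fintype.card_fin] at hd
      exact hd
    exact ⟨ζ, TwistEaterUniqueness.norm_eq_one_of_pow_eq_one hN0 hζN, hζN, hζ⟩
  -- Step 1b: common unit commutation phases for all ordered pairs of directions
  have hcomm : ∀ μ ν : Fin d, ∃ φ : ℂ, ‖φ‖ = 1 ∧ φ ^ N = 1 ∧ G μ * G ν = φ • (G ν * G μ) ∧
      G' μ * G' ν = φ • (G' ν * G' μ) := by
    intro μ ν
    rcases lt_trichotomy μ ν with hlt | rfl | hgt
    · obtain ⟨ζ, hζ1, hζN, hζ⟩ := hz ⟨(μ, ν), hlt⟩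
      have e1 : G μ * G ν = ζ • (G ν * G μ) := by
        have h := congrArg Subtype.val (hΓ μ ν hlt)
        change G μ * G ν = ((z ⟨(μ, ν), hlt⟩ : Matrix.specialUnitaryGroup (Fin N) ℂ) :
          Matrix (Fin N) (Fin N) ℂ) * (G ν * G μ) at h
        rw [h, hζ, Matrix.smul_mul, Matrix.one_mul]
      have e2 : G' μ * G' ν = ζ • (G' ν * G' μ) := by
        have h := congrArg Subtype.val (hΓ' μ ν hlt)
        change G' μ * G' ν = ((z ⟨(μ, ν), hlt⟩ : Matrix.specialUnitaryGroup (Fin N) ℂ) :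
          Matrix (Fin N) (Fin N) ℂ) * (G' ν * G' μ) at h
        rw [h, hζ, Matrix.smul_mul, Matrix.one_mul]
      exact ⟨ζ, hζ1, hζN, e1, e2⟩
    · exact ⟨1, norm_one, one_pow N, by rw [one_smul], by rw [one_smul]⟩
    · obtain ⟨ζ, hζ1, hζN, hζ⟩ := hz ⟨(ν, μ), hgt⟩
      have hζ0 : ζ ≠ 0 := fun h => by simp [h] at hζ1
      have e1 : G ν * G μ = ζ • (G μ * G ν) := by
        have h := congrArg Subtype.val (hΓ ν μ hgt)
        change G ν * G μ = ((z ⟨(ν, μ), hgt⟩ : Matrix.specialUnitaryGroup (Fin N) ℂ) :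
          Matrix (Fin N) (Fin N) ℂ) * (G μ * G ν) at h
        rw [h, hζ, Matrix.smul_mul, Matrix.one_mul]
      have e2 : G' ν * G' μ = ζ • (G' μ * G' ν) := by
        have h := congrArg Subtype.val (hΓ' ν μ hgt)
        change G' ν * G' μ = ((z ⟨(ν, μ), hgt⟩ : Matrix.specialUnitaryGroup (Fin N) ℂ) :
          Matrix (Fin N) (Fin N) ℂ) * (G' μ * G' ν) at h
        rw [h, hζ, Matrix.smul_mul, Matrix.one_mul]
      refine ⟨ζ⁻¹, by rw [norm_inv, hζ1, inv_one], by rw [inv_pow, hζN, inv_one], ?_, ?_⟩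
      · rw [e1, smul_smul, inv_mul_cancel₀ hζ0, one_smul]
      · rw [e2, smul_smul, inv_mul_cancel₀ hζ0, one_smul]
  -- Step 1c: `Γ_μ^{N²} = 1`, `Γ'_μ^{N²} = 1`
  have hpow : ∀ μ, G μ ^ (N * N) = 1 :=
    TwistEaterUniqueness.pow_mul_self_eq_one G hirrG hdet fun μ ν => by
      obtain ⟨φ, -, hφN, h, -⟩ := hcomm μ ν; exact ⟨φ, hφN, h⟩
  have hpow' : ∀ μ, G' μ ^ (N * N) = 1 :=
    TwistEaterUniqueness.pow_mul_self_eq_one G' hirrG' hdet' fun μ ν => by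
      obtain ⟨φ, -, hφN, -, h⟩ := hcomm μ ν; exact ⟨φ, hφN, h⟩
  -- Step 2: a non-zero twisted invariant; Step 3: Schur
  obtain ⟨Ω₀, hΩ0, hΩ⟩ := TwistEaterUniqueness.exists_twisted_invariant G G'
    (Nat.mul_pos hNpos hNpos) hpow hpow' fun μ ν => by
      obtain ⟨φ, hφ1, -, h, h'⟩ := hcomm μ ν; exact ⟨φ, hφ1, h, h'⟩
  choose c hc hcΩ using hΩ
  obtain ⟨U, hUU, hUrel⟩ :=
    TwistEaterUniqueness.exists_unitary_intertwiner G G' hU hU' hirrG hΩ0 hc hcΩ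
  -- Step 4: normalise the determinant
  have hUU' : U * Uᴴ = 1 := mul_eq_one_comm.1 hUU
  have hδδ : U.det * star U.det = 1 := by
    rw [← Matrix.det_conjTranspose, ← Matrix.det_mul, hUU', Matrix.det_one]
  have hδ1 : ‖U.det‖ = 1 := by
    have h : ‖U.det‖ ^ 2 = 1 := by
      have h' := congrArg norm hδδ
      rwa [norm_mul, norm_star, norm_one, ← sq] at h'
    exact (pow_eq_one_iff_of_nonneg (norm_nonneg _) two_ne_zero).1 h
  obtain ⟨ε, hε⟩ := IsAlgClosed.exists_pow_nat_eq (star U.det) hNpos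
  have hε1 : ‖ε‖ = 1 := by
    have h : ‖ε‖ ^ N = 1 := by rw [← norm_pow, hε, norm_star, hδ1]
    exact (pow_eq_one_iff_of_nonneg (norm_nonneg ε) hN0).1 h
  set V : Matrix (Fin N) (Fin N) ℂ := ε • U with hV
  have hVV : Vᴴ * V = 1 := by
    rw [hV, Matrix.conjTranspose_smul, Matrix.smul_mul, Matrix.mul_smul, smul_smul, hUU,
      TwistEaterUniqueness.star_mul_self_of_norm_eq_one hε1, one_smul]
  have hVV' : V * Vᴴ = 1 := mul_eq_one_comm.1 hVV
  have hVdet : V.det = 1 := by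
    rw [hV, Matrix.det_smul, Fintype.card_fin, hε, mul_comm, hδδ]
  have hVmem : V ∈ Matrix.specialUnitaryGroup (Fin N) ℂ :=
    Matrix.mem_specialUnitaryGroup_iff.2 ⟨Matrix.mem_unitaryGroup_iff'.2 hVV, hVdet⟩
  have hconj : ∀ ν, G' ν = c ν • (V * G ν * Vᴴ) := by
    intro ν
    have hVrel : G' ν * V = c ν • (V * G ν) := by
      rw [hV, Matrix.mul_smul, Matrix.smul_mul, hUrel ν, smul_comm]
    calc G' ν = G' ν * V * Vᴴ := by rw [mul_assoc, hVV', mul_one]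
      _ = c ν • (V * G ν * Vᴴ) := by rw [hVrel, Matrix.smul_mul]
  -- the phases are `N`-th roots of unity, i.e. centre phases `ω^k`
  have hcN : ∀ ν, c ν ^ N = 1 := by
    intro ν
    have h := congrArg Matrix.det (hconj ν)
    rw [hdet' ν, Matrix.det_smul, Fintype.card_fin, Matrix.det_mul, Matrix.det_mul, hVdet, hdet ν,
      Matrix.det_conjTranspose, hVdet, star_one, mul_one, mul_one, mul_one] at h
    exact h.symm
  have hω : IsPrimitiveRoot (Complex.exp (2 * Real.pi * Complex.I / N)) N :=
    Complex.isPrimitiveRoot_exp N hN0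
  have hm : ∀ ν, ∃ m : ℕ, m < N ∧ Complex.exp (2 * Real.pi * Complex.I / N) ^ m = c ν :=
    fun ν => by
      obtain ⟨i, hi, h⟩ := hω.eq_pow_of_pow_eq_one (hcN ν)
      exact ⟨i, hi, h⟩
  choose m hmN hm using hm
  have hphase : ∀ ν, centerPhase N (m ν : ZMod N) = c ν := by
    intro ν
    rw [← hm ν, centerPhase, ZMod.val_natCast, Nat.mod_eq_of_lt (hmN ν), ← Complex.exp_nat_mul]
    congr 1
    push_cast
    ring
  refine ⟨⟨V, hVmem⟩, fun ν => (m ν : ZMod N), fun ν => Subtype.ext ?_⟩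
  change G' ν = (centerPhase N (m ν : ZMod N) • (1 : Matrix (Fin N) (Fin N) ℂ)) *
    (V * G ν * star V)
  rw [hphase, Matrix.smul_mul, Matrix.one_mul, Matrix.star_eq_conjTranspose]
  exact hconj ν

end Literature.MathematicalPhysics.QuantumLattice
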